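import Literature.AlgebraicGeometry.Shioda1982.ExceptionalQuadruplesComplete
import HarnessLib

/-!
# Shioda 1982 / Meyer–Neutsch 1981: no exceptional quadruple at the level `N = 132` (kernel sweep)

Topic `Literature/AlgebraicGeometry/Shioda1982`; companion of `ExceptionalQuadruplesComplete.lean` (search `checkB`, soundness
`tabelleOneCompleteAt_of_chunks`, invariant form `exists_mem_reps_of_isExceptionalQuadruple`, statement `TabelleOneCompleteAt`; sources,
method and framing in its module docstring), of the sweeps `ExceptionalQuadruplesSweepSixty/…/Ninety.lean` (all `2 ≤ N ≤ 90`) and of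
`ExceptionalQuadruplesSweepOneHundredTwelve.lean` (`N = 112`). THEOREMS only (no definition, no named fact): the kernel search at the
single level `N = 132 = 2²·3·11`, which carries NO row of [MeyerNeutsch1981Fermatquadrupel, Tabelle 1] (computer-generated, "alle
Fermatquadrupel für N ≤ 614 ermittelt", §2 p. 53) and a zero in [Shioda1982PicardFermat, table p. 727]: `completeAt_oneHundredThirtyTwo`
(every sorted pair-free primitive Hodge 4-multiset mod `132` is standard) and `not_isExceptionalQuadruple_oneHundredThirtyTwo`. Use: `132`
is the one level `12p`, `p` prime, at which the classification of `HodgeQuadruplesTwelvePrime.lean` / `PicardNumberTwelvePrime.lean`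
(`p ≥ 17`) and the sweeps `≤ 90` (`p ≤ 7`: the levels `24, 36, 60, 84` ARE rows of Tabelle 1) leave the absence of exceptional quadruples
uncertified while Tabelle 1 has no row (`156 = 12·13` is a row, `ExceptionalQuadruplesComplete156.lean`); its non-standard indecomposable
elements are the imprimitive lifts of the exceptional elements of the levels `12` and `66`. `decide +kernel` only (no `native_decide`), in
`4` chunks of first entries to bound the memory of a single kernel evaluation.

HONEST FRAMING (cell `pub-hfermat`): explicit algebraic cycles for specific Hodge classes on Fermat/Delsarte varieties; residual open
instances listed; no claim on general Hodge. These classes are algebraic (Lefschetz (1,1)); certified here is only the emptiness of the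
exceptional list at this level.

## References
* [MeyerNeutsch1981Fermatquadrupel] W. Meyer, W. Neutsch, *Fermatquadrupel*, Math. Ann. 256 (1981) 51–62, §2 p. 53, Tabelle 1 p. 54 (no row `132`).
* [Shioda1982PicardFermat] T. Shioda, J. Fac. Sci. Univ. Tokyo IA 28 (1982) 725–734, table p. 727.
-/

namespace Literature.AlgebraicGeometry.Shioda1982

open Literature.AlgebraicGeometry.HodgeTheory

set_option maxHeartbeats 0 in
/-- **Tabelle 1 is complete at `N = 132`, where it is empty**: every sorted Hodge 4-multiset mod `132` without a pair and with
`gcd = 1` is standard. Kernel exhaustion (`checkB`), `4` chunks of first entries `a`.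
[cite: MeyerNeutsch1981Fermatquadrupel, §2 p. 53 ("alle Fermatquadrupel für N ≤ 614 ermittelt") and Tabelle 1 p. 54 (no row 132)]
[cite: Shioda1982PicardFermat, table p. 727] -/
theorem completeAt_oneHundredThirtyTwo : TabelleOneCompleteAt 132 :=
  tabelleOneCompleteAt_of_chunks 132 [(0, 8), (8, 10), (18, 18), (36, 96)] (by decide +kernel) (by
    intro p hp
    simp only [List.mem_cons, List.not_mem_nil, or_false] at hp
    rcases hp with rfl | rfl | rfl | rfl <;> decide +kernel)

/-- **No exceptional quadruple ("Ausnahmequadrupel") at the level `132`** (`tabelleOne 132 = []`).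
[cite: MeyerNeutsch1981Fermatquadrupel, Tabelle 1 p. 54 (no row 132)] [cite: Shioda1982PicardFermat, table p. 727] -/
theorem not_isExceptionalQuadruple_oneHundredThirtyTwo (s : Multiset (ZMod 132)) : ¬ IsExceptionalQuadruple 132 s := by
  intro hs
  obtain ⟨r, hr, -⟩ := exists_mem_reps_of_isExceptionalQuadruple completeAt_oneHundredThirtyTwo hs
  simp [reps, tabelleOne] at hr

end Literature.AlgebraicGeometry.Shioda1982
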